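import Literature.AlgebraicGeometry.Frobenioids.Birationalization
import HarnessLib

/-!
# Frobenioids I, Proposition 4.4 (i)/(ii): the category `C^birat` and the functor `C → C^birat`
(part 2)

Mochizuki, *The geometry of Frobenioids I: the general theory*, Kyushu J. Math. **62** (2008)
293–400, §4, Proposition 4.4 (i), (ii), kurims text pp. 82–85 [cite: MochizukiFrdI2008, Prop.
4.4(i) p.83]:
"(i) … hence a category `C^birat`, whose objects are the objects of `C` and whose morphisms are
given
by `Hom^birat_C`" and "(ii) … Moreover, the functor `C → C^birat` is faithful."

Over part 1 (`Birationalization.lean`: birational fractions, the colimit relation, composition by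
squares and its laws up to the relation) this file assembles the *birationalization*: the type
synonym `Birat F hF hsq` of `C` with hom-types `Hom^birat_C(A, B)` = fractions modulo the colimit
relation, its `Category` instance (Prop. 4.4 (i)), the natural functor `toBirat : C → C^birat`
("obtained by … the image of `φ`", `φ ↦ (id, φ)`), and its faithfulness (Prop. 4.4 (ii), by the
total
epimorphicity of `C`).  As in part 1 the square-completion property of Prop. 1.11 (vii) is the
hypothesis `hsq : HasBiratSquares F` (TODO-merge abc-iut-L1-t1).  Not here: the Frobenioid structure
`C^birat → F_{Φ^gp} → F_{0_D}` of (i)/(ii) (next part) and the dictionary (iv); the unit groups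
`O^×(A^birat)` are `BiratUnits.lean`.
-/

namespace Literature.AlgebraicGeometry.Frobenioids

open CategoryTheory Opposite

universe w v v' u u'

namespace PreFrobenioid

variable {D : Type u} [Category.{v} D] {Φ : Dᵒᵖ ⥤ CommMonCat.{w}}
  {C : Type u'} [Category.{v'} C]

/-- The **birationalization** `C^birat` of a Frobenioid `C` (FrdI Prop. 4.4 (i) p. 83): "the
category
whose objects are the objects of `C` and whose morphisms are given by `Hom^birat_C`" — a type
synonym
of `C` carrying the birational hom-types. [cite: MochizukiFrdI2008, Prop. 4.4(i) p.83] -/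
@[nolint unusedArguments]
def Birat (F : C ⥤ ElemFrobenioid Φ) (_hF : IsFrobenioid F) (_hsq : HasBiratSquares F) : Type u' :=
  C

namespace Birat

variable {F : C ⥤ ElemFrobenioid Φ} {hF : IsFrobenioid F} {hsq : HasBiratSquares F}

variable (F hF hsq) in
/-- An object of `C` regarded as an object of `C^birat` ("`A^birat`", Prop. 4.4 (ii)).
[cite: MochizukiFrdI2008, Prop. 4.4(ii) p.83] -/
def of (A : C) : Birat F hF hsq := A

/-- The underlying object of `C`. [cite: MochizukiFrdI2008, Prop. 4.4(i) p.83] -/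
def out (X : Birat F hF hsq) : C := X

/-- `out (of A) = A`. [cite: MochizukiFrdI2008, Prop. 4.4(i) p.83] -/
@[simp] theorem out_of (A : C) : (of F hF hsq A).out = A := rfl

/-- `Hom^birat_C(A, B)`: birational fractions modulo the colimit relation (FrdI Prop. 4.4, p. 82).
[cite: MochizukiFrdI2008, Prop. 4.4(i) p.83] -/
def Hom (X Y : Birat F hF hsq) : Type (max u' v') := Quotient (BiratFrac.setoid F hF X.out Y.out)

/-- The class of a fraction. [cite: MochizukiFrdI2008, Prop. 4.4(i) p.83] -/
def homMk {X Y : Birat F hF hsq} (f : BiratFrac F X.out Y.out) : Hom X Y :=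
  Quotient.mk (BiratFrac.setoid F hF X.out Y.out) f

/-- Every birational morphism is the class of a fraction.
[cite: MochizukiFrdI2008, Prop. 4.4(i) p.83] -/
theorem homMk_surjective {X Y : Birat F hF hsq} :
    Function.Surjective (homMk : BiratFrac F X.out Y.out → Hom X Y) :=
  Quotient.mk_surjective

/-- Two fractions define the same birational morphism iff they are related in the colimit.
[cite: MochizukiFrdI2008, Prop. 4.4(i) p.83] -/
theorem homMk_eq_homMk_iff {X Y : Birat F hF hsq} {f g : BiratFrac F X.out Y.out} :
    homMk f = homMk g ↔ BiratFrac.Rel f g :=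
  Quotient.eq (r := BiratFrac.setoid F hF X.out Y.out)

/-- Related fractions define the same birational morphism.
[cite: MochizukiFrdI2008, Prop. 4.4(i) p.83] -/
theorem homMk_sound {X Y : Birat F hF hsq} {f g : BiratFrac F X.out Y.out} (h : BiratFrac.Rel f g) :
    homMk f = homMk g :=
  homMk_eq_homMk_iff.mpr h

/-- Composition of birational morphisms (FrdI Prop. 4.4 (i), p. 84). [cite: MochizukiFrdI2008,
Prop. 4.4(i) p.84] -/
noncomputable def Hom.comp {X Y Z : Birat F hF hsq} (f : Hom X Y) (g : Hom Y Z) : Hom X Z :=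
  Quotient.map₂ (BiratFrac.comp hF hsq) (fun _ _ h₁ _ _ h₂ =>
    BiratFrac.Rel.trans hF (BiratFrac.comp_rel_left hF hsq _ h₁)
      (BiratFrac.comp_rel_right hF hsq _ h₂)) f g

/-- **Prop. 4.4 (i)**: `C^birat` is a category. [cite: MochizukiFrdI2008, Prop. 4.4(i) p.83] -/
noncomputable instance instCategory : Category.{max u' v'} (Birat F hF hsq) where
  Hom := Hom
  id X := homMk (BiratFrac.ofHom hF (𝟙 X.out))
  comp f g := Hom.comp f g
  id_comp f := by
    obtain ⟨f, rfl⟩ := homMk_surjective f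
    exact homMk_sound (BiratFrac.id_comp_rel hF hsq f)
  comp_id f := by
    obtain ⟨f, rfl⟩ := homMk_surjective f
    exact homMk_sound (BiratFrac.comp_id_rel hF hsq f)
  assoc f g k := by
    obtain ⟨f, rfl⟩ := homMk_surjective f
    obtain ⟨g, rfl⟩ := homMk_surjective g
    obtain ⟨k, rfl⟩ := homMk_surjective k
    exact homMk_sound (BiratFrac.comp_assoc_rel hF hsq f g k)

/-- Composition of classes of fractions is the class of the composite fraction.
[cite: MochizukiFrdI2008, Prop. 4.4(i) p.84] -/
theorem homMk_comp_homMk {X Y Z : Birat F hF hsq} (f : BiratFrac F X.out Y.out)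
    (g : BiratFrac F Y.out Z.out) :
    (homMk f ≫ homMk g : X ⟶ Z) = homMk (BiratFrac.comp hF hsq f g) := rfl

/-- Composition may be computed with ANY square. [cite: MochizukiFrdI2008, Prop. 4.4(i) p.84] -/
theorem homMk_comp_homMk_eq {X Y Z : Birat F hF hsq} (f : BiratFrac F X.out Y.out)
    (g : BiratFrac F Y.out Z.out) (S : BiratFrac.Square f g) :
    (homMk f ≫ homMk g : X ⟶ Z) = homMk (BiratFrac.compWith hF f g S) :=
  homMk_sound (BiratFrac.compWith_rel hF f g _ S)

/-- The identity of `A^birat` is the class of `(id, id)`. [cite: MochizukiFrdI2008, Prop. 4.4(i)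
p.83] -/
theorem id_eq (X : Birat F hF hsq) : (𝟙 X : X ⟶ X) = homMk (BiratFrac.ofHom hF (𝟙 X.out)) := rfl

end Birat

variable {F : C ⥤ ElemFrobenioid Φ}

variable (F) in
/-- **Prop. 4.4 (i)/(ii)**: the natural functor `C → C^birat`, identity on objects, `φ ↦ (id, φ)`.
[cite: MochizukiFrdI2008, Prop. 4.4(ii) p.83] -/
noncomputable def toBirat (hF : IsFrobenioid F) (hsq : HasBiratSquares F) : C ⥤ Birat F hF hsq where
  obj A := Birat.of F hF hsq A
  map φ := Birat.homMk (BiratFrac.ofHom hF φ)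
  map_id _ := rfl
  map_comp {A B B'} φ ψ := by
    -- square for `((id, φ), (id, ψ))`: `(id, φ)`
    let S : BiratFrac.Square (BiratFrac.ofHom hF φ) (BiratFrac.ofHom hF ψ) :=
      { apex := A, left := 𝟙 _, right := φ, left_mem := isCoAngularPreStep_id hF _
        w := by
          change 𝟙 _ ≫ φ = φ ≫ 𝟙 _
          rw [Category.id_comp, Category.comp_id] }
    refine ((Birat.homMk_comp_homMk_eq (X := Birat.of F hF hsq A) (Y := Birat.of F hF hsq B)
      (Z := Birat.of F hF hsq B') _ _ S).trans (Birat.homMk_sound ?_)).symm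
    refine ⟨A, 𝟙 _, 𝟙 _, isCoAngularPreStep_id hF _, isCoAngularPreStep_id hF _, ?_, rfl⟩
    change 𝟙 A ≫ 𝟙 A ≫ 𝟙 A = 𝟙 A ≫ 𝟙 A
    rw [Category.id_comp]

/-- `C → C^birat` on morphisms. [cite: MochizukiFrdI2008, Prop. 4.4(ii) p.83] -/
theorem toBirat_map (hF : IsFrobenioid F) (hsq : HasBiratSquares F) {A B : C} (φ : A ⟶ B) :
    (toBirat F hF hsq).map φ = Birat.homMk (BiratFrac.ofHom hF φ) := rfl

/-- **Prop. 4.4 (ii)**: "the functor `C → C^birat` is faithful" (`C` is totally epimorphic: if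
`(id, φ) ∼ (id, ψ)` then `ε ≫ φ = ε ≫ ψ` for a co-angular pre-step `ε`, an epimorphism).
[cite: MochizukiFrdI2008, Prop. 4.4(ii) p.83] -/
theorem toBirat_faithful (hF : IsFrobenioid F) (hsq : HasBiratSquares F) :
    (toBirat F hF hsq).Faithful := by
  refine ⟨fun {A B} φ ψ h => ?_⟩
  obtain ⟨E, ε, ε', hε, -, h₁, h₂⟩ := Birat.homMk_eq_homMk_iff.mp h
  have h₁' : (ε : E ⟶ A) = ε' := by
    have h' := h₁
    simp only [BiratFrac.ofHom, Category.comp_id] at h'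
    exact h'
  subst h₁'
  have h₂' : ε ≫ φ = ε ≫ ψ := h₂
  haveI : Epi ε := hF.isPreFrobenioid.isTotallyEpimorphic.epi ε
  exact (cancel_epi ε).mp h₂'

/-- Every birational morphism `A ⇢ B` is `α⁻¹` followed by `φ′` for a co-angular pre-step `α` and a
morphism `φ′` of `C`: `[(α, φ′)] ∘ α = φ′` in `C^birat`. [cite: MochizukiFrdI2008, Prop. 4.4(i)
p.83] -/
theorem toBirat_map_den_comp_homMk (hF : IsFrobenioid F) (hsq : HasBiratSquares F) {A B : C}
    (f : BiratFrac F A B) :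
    (toBirat F hF hsq).map f.den ≫
        (Birat.homMk f : (toBirat F hF hsq).obj A ⟶ (toBirat F hF hsq).obj B) =
      (toBirat F hF hsq).map f.num := by
  let S : BiratFrac.Square (BiratFrac.ofHom hF f.den) f :=
    { apex := f.src, left := 𝟙 _, right := 𝟙 _, left_mem := isCoAngularPreStep_id hF _
      w := rfl }
  refine (Birat.homMk_comp_homMk_eq (X := Birat.of F hF hsq f.src) (Y := Birat.of F hF hsq A)
    (Z := Birat.of F hF hsq B) _ _ S).trans (Birat.homMk_sound ?_)
  refine ⟨f.src, 𝟙 _, 𝟙 _, isCoAngularPreStep_id hF _, isCoAngularPreStep_id hF _, ?_, ?_⟩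
  · change 𝟙 _ ≫ 𝟙 _ ≫ 𝟙 _ = 𝟙 _ ≫ 𝟙 _
    rw [Category.id_comp]
  · change 𝟙 _ ≫ 𝟙 _ ≫ f.num = 𝟙 _ ≫ f.num
    rw [Category.id_comp]

end PreFrobenioid

end Literature.AlgebraicGeometry.Frobenioids
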